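import Mathlib
import Summits.ValiantsHypothesis.ValiantsHypothesis.Theorems.NewtonUnitEquationsDissociatedUniformTotalsLaw
import Summits.ValiantsHypothesis.ValiantsHypothesis.Theorems.NewtonUnitEquationsDissociatedUniformTotalsLawShares
import Summits.ValiantsHypothesis.ValiantsHypothesis.Theorems.NewtonUnitEquationsDissociatedUniformTotalsLawUnion
import Summits.ValiantsHypothesis.ValiantsHypothesis.Theorems.NewtonUnitEquationsDissociatedUniformTotalsLawUnionConverse
import Summits.ValiantsHypothesis.ValiantsHypothesis.Theorems.NewtonUnitEquationsDissociatedUniformTotalsLawChartTops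
import Summits.ValiantsHypothesis.ValiantsHypothesis.Theorems.NewtonUnitEquationsDissociatedUniformTotalsLawChartLevelsTopSets
import Literature.Computability.AlgebraicComplexity.NewtonPolygonTauProductBounds
import HarnessLib

/-!
# Crux `NewtonUnitEquations.DissociatedUniform` (stmt-ValiantsHypothesis-5905): totals law — fibre DEPTH dominates letter ranks (brick (R2))

Companion of `…TotalsLawUnion` / `…UnionConverse` (fibre unions `U_s(Z)`, `unionFin`) and `…ChartLevelsTopSets` (`rank σ F t p`).
Memo `Cruxes/DissociatedUniform/NOTES-t1g4.md` §4: along the chart `t ↦ (σ,t)` write `F_r(t)` for the support value of the fibre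
`P_r = {a x + b (r - x)}` (`fibreSup` of `…TotalsLawShares`) and `Above_r(t)` for the fibres with strictly larger support value (`aboveFibres`); the
DEPTH of the fibre `r` at time `t` is `#Above_r(t)`.

* `rank_le_card_aboveFibres_left/right` (R2, letter ranks): if `(x, r - x)` is a top pair of its fibre at time `t`, then the letter
  `a x` has rank `≤ #Above_r(t)` in the alphabet `A = a(G)` and `b (r - x)` has rank `≤ #Above_r(t)` in `B = b(G)` (the pairs
  `(x', r - x)` with `a x'` above `a x` lie in pairwise distinct fibres above `r`).
* `top_pair_of_isStrictTop_union`, `not_mem_of_mem_aboveFibres` (R2, unions): a strict top `p = a x + b (r - x)` of `U_s(Z)` (with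
  `s - r ∈ Z`) is a top pair of its fibre, and NO fibre above `r` sits at a position of `Z`: `s - r' ∉ Z` for `r' ∈ Above_r(t)` —
  the inheritance of a fibre piece is confined to the translates of `Z` avoiding its above-set.
Together with `…ChartLevelsPairs.card_shallowPairs_le_linear` (few letter pairs are simultaneously shallow) this bounds the number
of fibre pieces realised at depth `< k` in ANY union by `k²(16k(|A|+|B|)+1)` (R3).
Honest label: tool lemmas only; nothing here bears on VP ≠ VNP.
[folklore]
-/

set_option linter.dupNamespace false -- `ValiantsHypothesis.ValiantsHypothesis` (summit = problem) in every name

open scoped BigOperators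

namespace Summit.ValiantsHypothesis.ValiantsHypothesis.Theorems.NewtonUnitEquationsDissociatedUniform

namespace TotalsLaw

open Literature.Computability.AlgebraicComplexity.KPTT.PlanarMinkowski

variable {G : Type*} [AddCommGroup G] [Fintype G]

/-! ### Fibre support values and above-sets along a chart -/

/-- `Above_r(t)`: the fibres with strictly larger support value than `P_r` at the chart weight `(σ, t)` (support values
`fibreSup` from `…TotalsLawShares`). -/
noncomputable def aboveFibres (a b : G → (Fin 2 → ℝ)) (σ t : ℝ) (r : G) : Finset G :=
  Finset.univ.filter fun r' => fibreSup ![σ, t] a b r < fibreSup ![σ, t] a b r'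

/-- A top pair realises the support value. [folklore] -/
theorem fibreSup_eq_of_top (a b : G → (Fin 2 → ℝ)) (σ t : ℝ) (r x : G)
    (htop : ∀ x' : G, ![σ, t] ⬝ᵥ (a x' + b (r - x')) ≤ ![σ, t] ⬝ᵥ (a x + b (r - x))) :
    fibreSup ![σ, t] a b r = ![σ, t] ⬝ᵥ (a x + b (r - x)) := by
  refine le_antisymm ?_ (le_fibreSup ![σ, t] a b r x)
  unfold fibreSup
  exact Finset.sup'_le _ _ fun x' _ => htop x'

/-! ### (R2) for letters: fibre depth dominates letter ranks -/

/-- **Left letters.**  If `(x, r - x)` is a top pair of the fibre `P_r` at `(σ,t)` and `A` is the letter set `a(G)`, then the rank of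
`a x` in `A` is at most the depth `#Above_r(t)`: the pairs `(x', r - x)` with `a x'` above `a x` lie in pairwise distinct fibres
`x' + (r - x)`, all above `r`. [folklore] -/
theorem rank_le_card_aboveFibres_left (a b : G → (Fin 2 → ℝ)) (σ t : ℝ) (r x : G)
    (htop : ∀ x' : G, ![σ, t] ⬝ᵥ (a x' + b (r - x')) ≤ ![σ, t] ⬝ᵥ (a x + b (r - x)))
    (A : Finset (Fin 2 → ℝ)) (hA : (A : Set (Fin 2 → ℝ)) = Set.range a) :
    rank σ A t (a x) ≤ (aboveFibres a b σ t r).card := by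
  classical
  have hsup := fibreSup_eq_of_top a b σ t r x htop
  -- a label for every letter
  have hlab : ∀ q ∈ A.filter (fun q => ![σ, t] ⬝ᵥ a x < ![σ, t] ⬝ᵥ q), ∃ x' : G, a x' = q := by
    intro q hq
    have hqA : q ∈ (A : Set (Fin 2 → ℝ)) := Finset.mem_coe.2 (Finset.mem_filter.1 hq).1
    rw [hA] at hqA
    exact hqA
  choose! lab hlab' using hlab
  unfold rank
  refine Finset.card_le_card_of_injOn (fun q => lab q + (r - x)) (fun q hq => ?_) ?_
  · -- the fibre of `(lab q, r - x)` is above `r`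
    have hq' := (Finset.mem_filter.1 hq).2
    rw [Finset.mem_coe, aboveFibres, Finset.mem_filter]
    refine ⟨Finset.mem_univ _, ?_⟩
    have h1 := le_fibreSup ![σ, t] a b (lab q + (r - x)) (lab q)
    rw [show lab q + (r - x) - lab q = r - x by abel, hlab' q hq] at h1
    rw [hsup, dotProduct_add]
    rw [dotProduct_add] at h1
    linarith
  · intro q hq q' hq' h
    have : lab q = lab q' := add_right_cancel h
    rw [← hlab' q hq, ← hlab' q' hq', this]

/-- **Right letters.**  Symmetrically the rank of `b (r - x)` in `B = b(G)` is at most `#Above_r(t)`. [folklore] -/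
theorem rank_le_card_aboveFibres_right (a b : G → (Fin 2 → ℝ)) (σ t : ℝ) (r x : G)
    (htop : ∀ x' : G, ![σ, t] ⬝ᵥ (a x' + b (r - x')) ≤ ![σ, t] ⬝ᵥ (a x + b (r - x)))
    (B : Finset (Fin 2 → ℝ)) (hB : (B : Set (Fin 2 → ℝ)) = Set.range b) :
    rank σ B t (b (r - x)) ≤ (aboveFibres a b σ t r).card := by
  classical
  have hsup := fibreSup_eq_of_top a b σ t r x htop
  have hlab : ∀ q ∈ B.filter (fun q => ![σ, t] ⬝ᵥ b (r - x) < ![σ, t] ⬝ᵥ q), ∃ y' : G, b y' = q := by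
    intro q hq
    have hqB : q ∈ (B : Set (Fin 2 → ℝ)) := Finset.mem_coe.2 (Finset.mem_filter.1 hq).1
    rw [hB] at hqB
    exact hqB
  choose! lab hlab' using hlab
  unfold rank
  refine Finset.card_le_card_of_injOn (fun q => x + lab q) (fun q hq => ?_) ?_
  · have hq' := (Finset.mem_filter.1 hq).2
    rw [Finset.mem_coe, aboveFibres, Finset.mem_filter]
    refine ⟨Finset.mem_univ _, ?_⟩
    have h1 := le_fibreSup ![σ, t] a b (x + lab q) x
    rw [show x + lab q - x = lab q by abel, hlab' q hq] at h1
    rw [hsup, dotProduct_add]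
    rw [dotProduct_add] at h1
    linarith
  · intro q hq q' hq' h
    have : lab q = lab q' := add_left_cancel h
    rw [← hlab' q hq, ← hlab' q' hq', this]

/-! ### (R2) for unions: tops of a union are fibre tops, and the above-set avoids the positions -/

/-- A strict top of `U_s(Z)` lying in the fibre `r` (`s - r ∈ Z`) is a top pair of its fibre (all of `P_r` is in the union).
[folklore] -/
theorem top_pair_of_isStrictTop_union (a b : G → (Fin 2 → ℝ)) (Z : Set G) {σ t : ℝ} {s r x : G} (hr : s - r ∈ Z)
    (htop : IsStrictTop ![σ, t] (unionFin a b Z s) (a x + b (r - x))) :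
    ∀ x' : G, ![σ, t] ⬝ᵥ (a x' + b (r - x')) ≤ ![σ, t] ⬝ᵥ (a x + b (r - x)) := by
  intro x'
  refine htop.le ?_
  rw [← Finset.mem_coe, coe_unionFin]
  exact mem_unionPts.2 ⟨x', r - x', by rw [show s - x' - (r - x') = s - r by abel]; exact hr, rfl⟩

/-- **The above-set avoids the positions.**  If `a x + b (r - x)` is a strict top of `U_s(Z)` at `(σ,t)` then no fibre above
`r` is present in the union: `s - r' ∉ Z` for every `r' ∈ Above_r(t)`. [folklore] -/
theorem not_mem_of_mem_aboveFibres (a b : G → (Fin 2 → ℝ)) (Z : Set G) {σ t : ℝ} {s r x : G}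
    (htop : IsStrictTop ![σ, t] (unionFin a b Z s) (a x + b (r - x))) {r' : G} (hr' : r' ∈ aboveFibres a b σ t r) :
    s - r' ∉ Z := by
  intro hZ
  obtain ⟨x', hx'⟩ := exists_eq_fibreSup ![σ, t] a b r'
  have hmem : a x' + b (r' - x') ∈ unionFin a b Z s := by
    rw [← Finset.mem_coe, coe_unionFin]
    exact mem_unionPts.2 ⟨x', r' - x', by rw [show s - x' - (r' - x') = s - r' by abel]; exact hZ, rfl⟩
  have h1 := htop.le hmem
  have h2 := le_fibreSup ![σ, t] a b r x
  have h3 := (Finset.mem_filter.1 hr').2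
  linarith

/-- **(R2) packaged.**  A strict top `a x + b (r - x)` of `U_s(Z)` (fibre `r` present: `s - r ∈ Z`) at `(σ, t)` has both letters of
rank at most the depth `#Above_r(t)` in their alphabets. [folklore] -/
theorem ranks_le_depth_of_isStrictTop_union (a b : G → (Fin 2 → ℝ)) (Z : Set G) {σ t : ℝ} {s r x : G} (hr : s - r ∈ Z)
    (htop : IsStrictTop ![σ, t] (unionFin a b Z s) (a x + b (r - x)))
    (A B : Finset (Fin 2 → ℝ)) (hA : (A : Set (Fin 2 → ℝ)) = Set.range a) (hB : (B : Set (Fin 2 → ℝ)) = Set.range b) :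
    rank σ A t (a x) ≤ (aboveFibres a b σ t r).card ∧ rank σ B t (b (r - x)) ≤ (aboveFibres a b σ t r).card :=
  ⟨rank_le_card_aboveFibres_left a b σ t r x (top_pair_of_isStrictTop_union a b Z hr htop) A hA,
    rank_le_card_aboveFibres_right a b σ t r x (top_pair_of_isStrictTop_union a b Z hr htop) B hB⟩

end TotalsLaw

end Summit.ValiantsHypothesis.ValiantsHypothesis.Theorems.NewtonUnitEquationsDissociatedUniform
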